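import Literature.MathematicalPhysics.QuantumFieldTheory.Balaban1983to89.T4HistoryLipschitzLinearSize
import Literature.MathematicalPhysics.QuantumFieldTheory.Balaban1983to89.T4HistoryLipschitzWitness

/-!
# NE9LastCouplingReal — the displayed binder (L) `LastCouplingLipschitz` of the NE9-P2 end-to-end theorems SUPPLIED FROM A
REAL-VARIABLE DERIVATIVE BOUND in the last coupling (the ADOPTED branch of [I] p. 263 «C^∞-function of g_{j−1}» made
quantitative), and the lineage's END `NE9 ∧ FadingMemory` on the torus cube chart with (L) so replaced (cell `pub-balaban`,
T4-DAG §2 node U3 / §6 NE9; lineage t4-ne9-p2 = prover P2 «inductive route», generation 19; task F4 of the ROUND-2 skeleton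
`HOME/t4/skeletons/NE9-t4-ne9-p2.md` §4, supplier (iii) of leaf L12)

HONEST FRAMING (T4-DAG PAGE 1).  Rung (B)+1 on a FIXED finite torus — NOT infinite volume, NOT a mass gap, NOT the Clay problem.
NE9 (`T4OutputRate.NE9` ∧ `FadingMemory`) is a cell NEW ESTIMATE, NOT PRINTED, and is NOT discharged here: every theorem below is
bookkeeping over the ABSTRACT carriers of `T4OutputRate`; every analytic input is a DISPLAYED binder stated INLINE (no Prop-valued
definition is introduced).  [I] = [Balaban1987RG1] is quoted for TYPES only (ABSOLUTE RULE): p. 263 «It is a C^∞-function of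
g_{j−1} ∈ [0, γ], (or analytic), with a positive, absolute γ.» beside (1.18) «|𝐄^{(j)}(X, g_{j−1}, 𝐔, 𝐉)| ≤ E₀ exp(−κd_j(X))»;
p. 268 (2.13) «vanishes at g_k = 0».  NO modulus and NO derivative bound in the last coupling is printed anywhere in [I]–[III]
(cell GAPS G-ne9p2-1; located absence XREAD-U3 Q5/Q6 pp. 263–264, p. 266).  `FlowStep.BetaPertH`, (B), (B^μ) do not occur.

WHERE THIS SITS.  The lineage's END faces (`T4HistoryLipschitzSegment.cubeChart_ne9_and_fadingMemory_of_domainDecay`,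
`T4HistoryLipschitzLinearSize.torus_ne9_and_fadingMemory_of_linSizeDecay`) display ONE binder about two couplings:
(L) `LastCouplingLipschitz E W T Ψ κ lam` — the new-term map Lipschitz in its EXPLICIT last coupling at fixed old terms (the
DIAGONAL entry of the history-modulus matrix; all off-diagonal entries are manufactured by the renewal induction).  Two suppliers
exist in the tree: (i) `T4HistoryLipschitzLastCoupling.lastCouplingLipschitz_of_holo` (holomorphy in a COMPLEX coupling with a
uniform margin — the p. 266 «(or analytic)» branch) and (ii) the row owner's `NE9LastCouplingBridge.lastCouplingLipschitz_of_couplingTwoPoint`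
(activity-level coupling two-point data).  THIS LEAF adds (iii), the literal real-variable reading of the ADOPTED branch: ONE real
function `φ` of the last coupling through the window's values, differentiable on a convex set containing them with
`|φ′| ≤ lam k·e^{−κd(X)}` ⟹ (L), by the mean value inequality (Mathlib `Convex.norm_image_sub_le_of_norm_hasDerivWithin_le`).

WHAT IS PROVED (kernel, `[folklore]` bookkeeping; 0 sorry).
§1 `lastCouplingLipschitz_of_hasDerivWithin` — (L) from the inline DERIVATIVE-IN-THE-LAST-COUPLING binder (any convex set);
   `lastCouplingLipschitz_of_hasDerivAt_Icc` — the same with `HasDerivAt` on a coordinate box `Icc (lo k) (hi k)` containing the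
   window's k-th coordinates; `coord_mem_Icc_of_window` — for `W ⊆ T4OutputRate.Window γ` the box is `Icc 0 γ`.
§2 **`torus_ne9_and_fadingMemory_of_linSizeDecay_hasDeriv`** — the lineage's END on the torus cube chart with `hlast` REPLACED by
   the derivative binder; conclusion unchanged: `NE9 E W κ (prodModuli ℓ fun _ => μ) ∧ FadingMemory (ℓ/μ) μ (prodModuli ℓ fun _ => μ)`,
   `μ = ω + 4·lipbar·a₁·τ̄`.
§3 `witness_hasDerivInLastCoupling` — NON-VACUITY: the kernel witness data of `T4HistoryLipschitzWitness` (torus chart, channel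
   with memory (½)^{k−j}, new-term map `e^{−d}·s + Re newTerm`) satisfy the derivative binder with `lam ≡ 1` (φ affine, φ′ = e^{−d}).
DISGUISE TEST (for the node test).  The binder compares values of ONE real function at two values of ONE coordinate; it carries no
history modulus and no memory; with every other leaf of the literally printed Lemma-1 type it does NOT give fading memory
(`T4HistoryLipschitzRecursion.sticky_not_fadingMemory` has `lam ≡ 1`).  It is NOT PRINTED for Bałaban's terms (a derivative
bound is a quantitative form print does not state) — displayed, asserted nowhere.

References (TYPES only): [Balaban1987RG1] CMP 109 (1987) p. 263 (1.18), p. 266, (2.12)–(2.13) p. 268; [Balaban1988RG2Cluster]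
CMP 116 (1988) (2.13)–(2.15) pp. 14–15, (2.18)–(2.20) p. 16, Lemma 3 (2.38) p. 20, (2.41) p. 21 (the END's other binders).
Mechanism template (FORM only, published, outside the audited series): [Dimock2013] Rev. Math. Phys. 25 (2013) 1330010, §4.9
Lemma 22 (derivative bounds of the one-step maps in the coupling from analyticity + Cauchy; tree `Dimock2011to13/CauchyDerivativeBounds`).
-/

noncomputable section

namespace Summit.QuantumFields.BalabanUV.T4Continuum.NE9LastCouplingReal

open scoped BigOperators
open Metric Set MeasureTheory BoundedContinuousFunction
open Literature.Probability.LatticeModels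
open Literature.MathematicalPhysics.QuantumFieldTheory
open Literature.MathematicalPhysics.QuantumFieldTheory.Balaban1983to89
open Literature.MathematicalPhysics.QuantumFieldTheory.Balaban1983to89.T4OutputRate
open Literature.MathematicalPhysics.QuantumFieldTheory.Balaban1983to89.T4ActivityLipschitz
open Literature.MathematicalPhysics.QuantumFieldTheory.Balaban1983to89.T4HistoryLipschitzRecursion
open Literature.MathematicalPhysics.QuantumFieldTheory.Balaban1983to89.T4HistoryLipschitzOuter
open Literature.MathematicalPhysics.QuantumFieldTheory.Balaban1983to89.T4HistoryLipschitzActivity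
open Literature.MathematicalPhysics.QuantumFieldTheory.Balaban1983to89.T4HistoryLipschitzEntropy
open Literature.MathematicalPhysics.QuantumFieldTheory.Balaban1983to89.T4HistoryLipschitzCubeGeometry
open Literature.MathematicalPhysics.QuantumFieldTheory.Balaban1983to89.T4HistoryLipschitzActivity (ClusterGeom)
open Literature.MathematicalPhysics.QuantumFieldTheory.Balaban1983to89.T4HistoryLipschitzSegment
open Literature.MathematicalPhysics.QuantumFieldTheory.Balaban1983to89.T4HistoryLipschitzLinearSize
open Literature.MathematicalPhysics.QuantumFieldTheory.Balaban1983to89.T4HistoryLipschitzWitness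

variable {C : Carriers} {Bg ι : Type}

/-! ## §1 (L) from a derivative bound in the last coupling (the displayed binder is stated INLINE) -/

/-- **(L) FROM A DERIVATIVE BOUND IN THE LAST COUPLING (kernel; supplier (iii) of leaf L12).**  DISPLAYED binder (inline,
asserted nowhere for Bałaban's terms): for every history `g ∈ W`, step `k`, background `U` and scale-(k+1) domain `X` there is ONE
real function `φ` with a derivative `φ′` WITHIN a CONVEX set `I ⊆ ℝ` containing the k-th coordinates of all window histories, with
`|φ′| ≤ lam k·e^{−κd(X)}` on `I`, and `φ (g′ k) = Ψ k (g′ k) (T k g′ (E g)) U X` for every `g′ ∈ W` (the channel reads its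
comparison history only through the k-th coupling — the STRUCTURE of [I] (2.13) p. 268, inherited from `LastCouplingLipschitz`).
CONCLUSION: `LastCouplingLipschitz E W T Ψ κ lam` — the mean value inequality on `I`.  Printed TYPE only: [I] p. 263 «It is a
C^∞-function of g_{j−1} ∈ [0, γ]»; no derivative bound is printed (G-ne9p2-1). [folklore] -/
theorem lastCouplingLipschitz_of_hasDerivWithin {E : Functional C Bg} {W : Set (ℕ → ℝ)}
    {T : ℕ → (ℕ → ℝ) → (Bg → C.Dom → ℝ) → ι → ℝ} {Ψ : ℕ → ℝ → (ι → ℝ) → Bg → C.Dom → ℝ} {κ : ℝ} {lam : ℕ → ℝ}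
    (hder : ∀ g ∈ W, ∀ (k : ℕ) (U : Bg) (X : C.Dom), C.scale X = k + 1 →
      ∃ (φ φ' : ℝ → ℝ) (I : Set ℝ), Convex ℝ I ∧ (∀ s ∈ I, HasDerivWithinAt φ (φ' s) I s) ∧
        (∀ s ∈ I, |φ' s| ≤ lam k * Real.exp (-(κ * C.d X))) ∧
        (∀ g' ∈ W, g' k ∈ I) ∧ (∀ g' ∈ W, φ (g' k) = Ψ k (g' k) (T k g' (E g)) U X)) :
    LastCouplingLipschitz E W T Ψ κ lam := by
  intro g hg g' hg' k U X hX
  obtain ⟨φ, φ', I, hI, hφ, hbd, hmem, hagree⟩ := hder g hg k U X hX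
  rw [← hagree g hg, ← hagree g' hg']
  have h := hI.norm_image_sub_le_of_norm_hasDerivWithin_le hφ
    (fun s hs => by rw [Real.norm_eq_abs]; exact hbd s hs) (hmem g' hg') (hmem g hg)
  rw [Real.norm_eq_abs, Real.norm_eq_abs] at h
  calc |φ (g k) - φ (g' k)| ≤ lam k * Real.exp (-(κ * C.d X)) * |g k - g' k| := h
    _ = Real.exp (-(κ * C.d X)) * (lam k * |g k - g' k|) := by ring

/-- **(L) FROM `HasDerivAt` ON A COORDINATE BOX (kernel).**  The same with an everywhere-differentiable-on-the-box `φ`: the k-th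
coordinates of the window lie in `Icc (lo k) (hi k)`, `φ` has derivative `φ′ s` at every `s` of that box with
`|φ′ s| ≤ lam k·e^{−κd(X)}`, and `φ` agrees with the new term along the window.  (`HasDerivAt ⇒ HasDerivWithinAt`, `convex_Icc`.)
[folklore] -/
theorem lastCouplingLipschitz_of_hasDerivAt_Icc {E : Functional C Bg} {W : Set (ℕ → ℝ)}
    {T : ℕ → (ℕ → ℝ) → (Bg → C.Dom → ℝ) → ι → ℝ} {Ψ : ℕ → ℝ → (ι → ℝ) → Bg → C.Dom → ℝ} {κ : ℝ} {lam lo hi : ℕ → ℝ}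
    (hbox : ∀ g ∈ W, ∀ k, g k ∈ Icc (lo k) (hi k))
    (hder : ∀ g ∈ W, ∀ (k : ℕ) (U : Bg) (X : C.Dom), C.scale X = k + 1 →
      ∃ (φ φ' : ℝ → ℝ), (∀ s ∈ Icc (lo k) (hi k), HasDerivAt φ (φ' s) s) ∧
        (∀ s ∈ Icc (lo k) (hi k), |φ' s| ≤ lam k * Real.exp (-(κ * C.d X))) ∧
        (∀ g' ∈ W, φ (g' k) = Ψ k (g' k) (T k g' (E g)) U X)) :
    LastCouplingLipschitz E W T Ψ κ lam := by
  refine lastCouplingLipschitz_of_hasDerivWithin fun g hg k U X hX => ?_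
  obtain ⟨φ, φ', hφ, hbd, hagree⟩ := hder g hg k U X hX
  exact ⟨φ, φ', Icc (lo k) (hi k), convex_Icc _ _, fun s hs => (hφ s hs).hasDerivWithinAt, hbd,
    fun g' hg' => hbox g' hg' k, hagree⟩

/-- For a window inside `T4OutputRate.Window γ = {g | ∀ i, 0 < g i ∧ g i ≤ γ}` ([I] Thm 1 p. 259 «contained in an interval
]0, γ]») the coordinate box of `lastCouplingLipschitz_of_hasDerivAt_Icc` may be taken `Icc 0 γ` at every step. [folklore] -/
theorem coord_mem_Icc_of_window {W : Set (ℕ → ℝ)} {γ : ℝ} (hW : W ⊆ Window γ) :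
    ∀ g ∈ W, ∀ k, g k ∈ Icc ((fun _ : ℕ => (0 : ℝ)) k) ((fun _ : ℕ => γ) k) := by
  intro g hg k
  have h := (mem_window.1 (hW hg)) k
  exact ⟨h.1.le, h.2⟩

/-! ## §2 The lineage's END on the torus cube chart with (L) supplied by the derivative binder -/

section EndToEnd

variable {ν N : ℕ} {D : ℕ}
variable {Sp : Type*} [TopologicalSpace Sp] [MeasurableSpace Sp] [OpensMeasurableSpace Sp] {F : Type*}
  [Fintype F] {Ω : Type*} [MeasurableSpace Ω]

/-- **NE9 ∧ FADING MEMORY ON A TORUS CUBE CHART, (L) FROM A DERIVATIVE BOUND (kernel end-to-end).**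
`T4HistoryLipschitzLinearSize.torus_ne9_and_fadingMemory_of_linSizeDecay` with its binder `hlast : LastCouplingLipschitz E W T Ψ κ lam`
REPLACED by the inline derivative-in-the-last-coupling binder of §1 (one real `φ` per (g, k, U, X), derivative within a convex set
containing the window's k-th coordinates, `|φ′| ≤ lam k·e^{−κd(X)}`, agreement along the window).  Every other binder and the
conclusion are those of the v1.0.2 theorem VERBATIM (recursion-side STRUCTURE `ScaleZeroFree`/`AdmissibleTerms`/`AdmRestrict`/
`ChannelAdditive`/`ChannelStepSum`, per-creation-step channel size `ChannelSizeAtStepNN` with envelope `τ k j ≤ τ̄ω^{k−j}`,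
`Factorises`, read-out/representation, explicit part + budget, regularity data, (L‴) decay of the coefficient tables in the linear
size, (A″) decay of the box majorant, KP scalars).  Nothing of [I]–[III] asserted; rung (B)+1 bookkeeping on a finite torus.
[folklore] -/
theorem torus_ne9_and_fadingMemory_of_linSizeDecay_hasDeriv (Γ : CubeChart C (Fin ν → ZMod N) (torusAdj ν N) D)
    {E : Functional C Bg}
    {W : Set (ℕ → ℝ)} {Adm : Set (Bg → C.Dom → ℝ)} {T : ℕ → (ℕ → ℝ) → (Bg → C.Dom → ℝ) → ι → ℝ}
    {Ψ : ℕ → ℝ → (ι → ℝ) → Bg → C.Dom → ℝ}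
    {μ : ℕ → ℝ → Bg → Finset (Fin ν → ZMod N) → Measure Ω} {pre : ℕ → ℝ → Bg → Finset (Fin ν → ZMod N) → Ω → ℂ}
    {c : ℕ → ℝ → Bg → Finset (Fin ν → ZMod N) → Ω → F → ℂ}
    {pt : ℕ → ℝ → Bg → Finset (Fin ν → ZMod N) → Ω → F → Sp} {β : ℕ → Sp → ℝ}
    {dom : ℕ → Finset (Fin ν → ZMod N) → F → Finset (Fin ν → ZMod N)}
    {lip ε α4 : ℕ → ℝ} {y a₁ d₁ θ κ lipbar ℓ τbar ω a θ₁ : ℝ} {wt : ℕ → ι → ℝ} {τ : ℕ → ℕ → ℝ} {lam p₀ Nsz : ℕ → ℝ}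
    (ρ : ℕ → (ι → ℝ) → (Sp →ᵇ ℂ))
    (h0 : ScaleZeroFree E W) (hAdm : AdmissibleTerms E W Adm) (hres : AdmRestrict Adm)
    (hadd : ChannelAdditive Adm T) (hsum : ChannelStepSum Adm T) (hstep : ChannelSizeAtStepNN Adm T κ wt τ)
    (hfac : Factorises E W T Ψ)
    -- (L) REPLACED: derivative-in-the-last-coupling binder (inline)
    (hder : ∀ g ∈ W, ∀ (k : ℕ) (U : Bg) (X : C.Dom), C.scale X = k + 1 →
      ∃ (φ φ' : ℝ → ℝ) (I : Set ℝ), Convex ℝ I ∧ (∀ s ∈ I, HasDerivWithinAt φ (φ' s) I s) ∧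
        (∀ s ∈ I, |φ' s| ≤ lam k * Real.exp (-(κ * C.d X))) ∧
        (∀ g' ∈ W, g' k ∈ I) ∧ (∀ g' ∈ W, φ (g' k) = Ψ k (g' k) (T k g' (E g)) U X))
    (hρ : ∀ (k : ℕ) (P P' : ι → ℝ) (M : ℝ), (∀ y, |P y - P' y| ≤ wt k y * M) → ‖ρ k P - ρ k P'‖ ≤ M)
    (hΨ : ∀ (k : ℕ) (s : ℝ) (P P' : ι → ℝ) (U : Bg) (X : C.Dom),
      Ψ k s P U X - Ψ k s P' U X =
        (Γ.geom.newTerm (Γ.geom.avgExpLinearAct μ pre fun k s U γ ω => evalFunctional (c k s U γ ω) (pt k s U γ ω))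
            k s U X (ρ k P) -
          Γ.geom.newTerm (Γ.geom.avgExpLinearAct μ pre fun k s U γ ω => evalFunctional (c k s U γ ω) (pt k s U γ ω))
            k s U X (ρ k P')).re)
    (hexpl : ∀ g ∈ W, ∀ (k : ℕ) (P : ι → ℝ) (U : Bg) (X : C.Dom), C.scale X = k + 1 →
      |Ψ k (g k) P U X -
          (Γ.geom.newTerm (Γ.geom.avgExpLinearAct μ pre fun k s U γ ω => evalFunctional (c k s U γ ω) (pt k s U γ ω))
            k (g k) U X (ρ k P)).re| ≤ Real.exp (-(κ * C.d X)) * p₀ k)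
    (hbase : ∀ g ∈ W, ∀ (U : Bg) (X : C.Dom), C.scale X = 0 → |E g U X| ≤ Real.exp (-(κ * C.d X)) * Nsz 0)
    (hNsucc : ∀ j, p₀ j + a₁ ≤ Nsz (j + 1)) (hNnn : ∀ j, 0 ≤ Nsz j)
    (hbox : ∀ (k : ℕ) (P : ι → ℝ), (∀ y, |P y| ≤ wt k y * sizeRadius τ Nsz k) → ∀ x, ‖ρ k P x‖ ≤ β k x)
    (hpre : ∀ k s U γ, AEStronglyMeasurable (pre k s U γ) (μ k s U γ))
    (hc : ∀ k s U γ Y, AEStronglyMeasurable (fun ω => c k s U γ ω Y) (μ k s U γ))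
    (hpt : ∀ k s U γ Y, Measurable fun ω => pt k s U γ ω Y) (hlip : ∀ k, 0 < lip k) (hlipb : ∀ k, lip k ≤ lipbar)
    (hint₀ : ∀ k s U γ, Integrable (fun ω => ‖pre k s U γ ω‖ * Real.exp (boxExponent c pt β k s U γ ω)) (μ k s U γ))
    (hmeet : ∀ k s U (γ : Finset (Fin ν → ZMod N)) ω Y, c k s U γ ω Y ≠ 0 → ∃ x ∈ γ, x ∈ dom k γ Y)
    (hα4 : ∀ k, 0 ≤ α4 k) (ha : 0 ≤ a) (hθ₁ : Real.exp (-(a / 2 ^ ν)) * Real.exp (D * θ₁) ≤ θ₁)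
    (hliplb : ∀ k, α4 k * Real.exp a * θ₁ ≤ lip k)
    (hlin : ∀ k s U (γ : Finset (Fin ν → ZMod N)) ω Y,
      ‖c k s U γ ω Y‖ ≤ α4 k * Real.exp (-(a * (linSize (dom k γ Y) : ℝ))))
    (hdomconn : ∀ k (γ : Finset (Fin ν → ZMod N)) Y, (dom k γ Y).Nonempty →
      ∃ b ∈ dom k γ Y, Polymer.IsConn (torusAdj ν N) (dom k γ Y) b)
    (hdominj : ∀ k (γ : Finset (Fin ν → ZMod N)), Set.InjOn (dom k γ) {Y | (dom k γ Y).Nonempty})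
    (hε : ∀ k, 0 ≤ ε k) (hy : 0 ≤ y)
    (hdecay₀ : ∀ g ∈ W, ∀ (k : ℕ) (U : Bg) (X : C.Dom), C.scale X = k + 1 → ∀ γ' ∈ Γ.vol X,
      ∫ ω, ‖pre k (g k) U γ' ω‖ * Real.exp (boxExponent c pt β k (g k) U γ' ω) ∂(μ k (g k) U γ') ≤ ε k * y ^ γ'.card)
    (hθ : 2 * y * Real.exp (a₁ + d₁) * Real.exp (D * θ) ≤ θ) (hεθ : ∀ k, 2 * ε k * θ * ((D : ℝ) + 1) ≤ a₁)
    (ha₁ : 0 ≤ a₁) (hκ : 0 ≤ κ) (hκd : κ ≤ d₁) (hℓ : 0 ≤ ℓ) (hτbar : 0 ≤ τbar) (hω : 0 ≤ ω)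
    (hpos : 0 < ω + 4 * lipbar * a₁ * τbar) (hlam : ∀ k, lam k ≤ ℓ)
    (hτ : ∀ k j, j ≤ k → 0 ≤ τ k j ∧ τ k j ≤ τbar * ω ^ (k - j)) :
    NE9 E W κ (prodModuli ℓ fun _ => ω + 4 * lipbar * a₁ * τbar) ∧
      FadingMemory (ℓ / (ω + 4 * lipbar * a₁ * τbar)) (ω + 4 * lipbar * a₁ * τbar)
        (prodModuli ℓ fun _ => ω + 4 * lipbar * a₁ * τbar) :=
  torus_ne9_and_fadingMemory_of_linSizeDecay Γ ρ h0 hAdm hres hadd hsum hstep hfac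
    (lastCouplingLipschitz_of_hasDerivWithin hder) hρ hΨ hexpl hbase hNsucc hNnn hbox hpre hc hpt hlip hlipb hint₀ hmeet hα4
    ha hθ₁ hliplb hlin hdomconn hdominj hε hy hdecay₀ hθ hεθ ha₁ hκ hκd hℓ hτbar hω hpos hlam hτ

end EndToEnd

/-! ## §3 Non-vacuity on the kernel witness of `T4HistoryLipschitzWitness` -/

section Witness

variable (ν N : ℕ)

/-- **THE DERIVATIVE BINDER IS INHABITED BY THE LINEAGE'S WITNESS DATA (kernel).**  On the torus cube chart with the witness
channel `wT` (memory (½)^{k−j}), functional `wE` (defined by the recursion) and new-term map `wΨ k s P U X = e^{−1·d(X)}·s + Re newTerm`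
(activities independent of `s`), for ANY window `W`: at (g, k, U, X) take `φ s = e^{−d(X)}·s + Re newTerm(tables of g)`, `φ′ ≡ e^{−d(X)}`,
`I = univ`; then `|φ′| = e^{−d(X)} = lam·e^{−κd}` with `lam ≡ 1`, `κ = 1`, and `φ (g′ k) = wΨ k (g′ k) (wT k g′ (wE g)) U X` by the
telescoping identity `wT_wE`.  (Feeding this into `lastCouplingLipschitz_of_hasDerivWithin` returns exactly the landed
`T4HistoryLipschitzWitness.w_lastCoupling` — not restated here.) [folklore] -/
theorem witness_hasDerivInLastCoupling (W : Set (ℕ → ℝ)) :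
    ∀ g ∈ W, ∀ (k : ℕ) (U : Unit) (X : (torusCarriers ν N).Dom), (torusCarriers ν N).scale X = k + 1 →
      ∃ (φ φ' : ℝ → ℝ) (I : Set ℝ), Convex ℝ I ∧ (∀ s ∈ I, HasDerivWithinAt φ (φ' s) I s) ∧
        (∀ s ∈ I, |φ' s| ≤ (fun _ : ℕ => (1 : ℝ)) k * Real.exp (-(1 * (torusCarriers ν N).d X))) ∧
        (∀ g' ∈ W, g' k ∈ I) ∧
        (∀ g' ∈ W, φ (g' k) = wΨ ν N k (g' k) (wT ν N k g' (wE ν N g)) U X) := by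
  intro g _ k U X _
  set cst : ℝ := ((torusChart ν N).geom.newTerm (wAct ν N) k (g k) U X (wρ k fun _ => wOut ν N g k)).re with hcst
  refine ⟨fun s => Real.exp (-(1 * (torusCarriers ν N).d X)) * s + cst,
    fun _ => Real.exp (-(1 * (torusCarriers ν N).d X)), Set.univ, convex_univ, ?_, ?_, fun _ _ => Set.mem_univ _, ?_⟩
  · intro s _
    exact (((hasDerivAt_id s).const_mul _).add_const cst).hasDerivWithinAt |>.congr_deriv (by simp)
  · intro s _
    rw [abs_of_pos (Real.exp_pos _)]
    simp
  · intro g' _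
    rw [wT_wE ν N g g' k, hcst]
    simp only [wΨ]
    rw [wNewTerm_indep ν N k (g' k) (g k)]

end Witness

end Summit.QuantumFields.BalabanUV.T4Continuum.NE9LastCouplingReal

end
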